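import Summits.BirchSwinnertonDyer.BirchSwinnertonDyer.Theses.UniversalToricDescent
import Summits.BirchSwinnertonDyer.BirchSwinnertonDyer.Theorems.UniversalToricDescentToricTransportModThreeStubRatSqueeze
import Summits.BirchSwinnertonDyer.BirchSwinnertonDyer.Theorems.UniversalToricDescentAcDualMuZeroCriterion
import Literature.Barriers.BirchSwinnertonDyer.TraceZeroHeegnerTowerAtAdditiveSplitP
import Mathlib.RingTheory.Length
import HarnessLib

/-!
# Crux node `resolvent_layer_index` (crux-ideate g11) for `AdditiveSplitIMCInclusionAtThree` (THE WALL, item 20395)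

**RESOLVENT-EXACT LAYER KOLYVAGIN AT THE ADDITIVE PRIME** — a `μ`-source for the wall that never builds a
`Λ`-adic class on the algebraic side. Kernel road (g8, LANDED criterion + RatSqueeze):
`RATWALL (24207) → ResidualSelmerFiniteAtThreeSurj (μ(X_(∅,0)) = 0) → WALL`, concluded BY NAME in §4.
The NEW content is the source of `μ(X_(∅,0)) = 0` (line card `Lines/resolvent_layer_index.md` §1):

* **(E1) `𝔾_a`-dictionary** (ATTACKABLE, tree lemmas `Rank1Residual.Additive.norm_coeff_formalLog_baseChange_le_one_of_addv`
  / `…formalExp…`): `E` additive at `3` ⇒ `Ê ≅ 𝔾̂_a` STRICTLY over `ℤ₃` ⇒ `E₁(F) ≅ (𝔪_F, +)` Galois-equivariantly for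
  every `F/ℚ₃`; along `K[3^m]_𝔭·ℚ₃^{ur}` the local points ARE `⊕_{k≤m} 𝒪_k·ζ_{3^k}` (`𝒪_k = W[ζ_{3^k}]`), and the
  trace-zero relation of the Heegner tower IS `Tr(ζ_{3^{m+1}}) = 0`.
* **(E2) disc dictionary** (INSTRUMENTABLE, print-adjacent BDP13 §5 / Katz–Serre–Tate): `loc_𝔭 y_ζ = Φ(ζ)`,
  `log_E Φ = G ∈ W⟦t−1⟧^{ψ=0}` (`a₃ = 0`), Mellin(`G`) `= 𝓛^{ac}` (square root of the BDP-frame `L`, up to a unit).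
* **(E3) exact resolvent index** (ATTACKABLE given E1+E2): `log loc_𝔭 κ^{(k)} = 𝓛^{ac}(χ̄_k)·τ(χ_k)` and the
  Gauss-sum element `τ(χ_k)` GENERATES the `χ_k`-eigenline of `𝒪_F ⊗ 𝒪_k` (eigenvectors are supported on primitive
  residues) ⇒ `ind_𝔭(κ^{(k)}) = v_{𝒪_k}(𝓛^{ac}(χ̄_k))` ON THE NOSE — no Gauss-sum / idempotent-denominator slack
  (the `O(m)` of the LEAD's K2(b-loc) and the constants of `mu_dominance_relative_teeth` RT3 do not arise).
* **(CRT) one-sided Chinese remainder for lengths** (PROVED here, §2): `(∏ xᵢ)·M = 0 ⇒ ℓ(M) ≤ Σᵢ ℓ(M/xᵢM)`.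
  With `xᵢ = Φ_{3^k}(γ)`, `k ≤ m`: `ℓ(X/ω_m X) ≤ Σ_k ℓ(X ⊗_Λ 𝒪_k)` — the semisimplification defect `(3^m−1)/2` of
  `ℤ₃[ℤ/3^m]` is ONE-SIDED and never enters an UPPER bound (answers barrier note B-g10-5 «χ-wise only»).
* **(TW) primitive-twist error lemma** (ATTACKABLE): a local error module `A ⊗ 𝒪_k(χ_k)` at a prime where
  `χ_k` has order `3^{k−O(1)}` (`𝔭, 𝔭′` ramified; `v ∣ N′` split in `K`, finitely decomposed in `K_∞`) has LENGTH
  `≤ 3^{s_v}·ℓ(A) = O(1)` because `ζ′ − 1 = π^{3^s}·unit`: every Tamagawa / torsion / `𝔪`-vs-`𝒪` slack is `O(1)`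
  per conductor in LENGTH units (valuation-unit slack is a `μ`-loss; length-unit slack is harmless).
* **(K) sharp twisted Kolyvagin per conductor** (IDEA-NEEDED/print-adjacent: Howard 2004 Thm. A, Mazur–Rubin 2004
  Thm. 5.2.2 over the DVR `𝒪_k` for `T ⊗ χ_k⁻¹`, BK structure; `κ^{(k)} ≠ 0 ∀ k ≫ 0` by Cornut–Vatsal 2007):
  `ℓ(X_BK,tors(T_k)) ≤ 2·[S_k : 𝒪_k κ^{(k)}]`, NO error term under (H.0)–(H.5) (uniform in `k`: residually `χ_k ≡ 1`).
* **(PT) finite-level Poitou–Tate conversion** (WEAKER, print: Castella 2013 / BDP-IMC ⟺ HP-IMC):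
  `ℓ(X_(∅,0)(T_k)) ≤ ℓ(X_BK,tors) + 2·ind_𝔭(κ^{(k)}) − 2·[S_k : κ^{(k)}] + O(1) ≤ 2·v(𝓛^{ac}(χ̄_k)) + O(1)`.
* **(H) Hsieh B any level** (tree fact `Hsieh2014.thmB_exists_isHsiehLFunction_coeff_norm_eq_one_unrPeriod_anyLevel`
  + INSTRUMENTABLE unit comparison disc-measure ↔ `IsHsiehLFunction`): `μ(𝓛^{ac}) = 0`.
Sum over conductors `≤ 3^m` with (CRT)+(TW)+control: `ℓ(X/ω_mX) ≤ μ(L̃)·3^m + λ(L̃)·m + O(m)`, `L̃ = (𝓛^{ac})²`, so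
`μ(X_(∅,0)) ≤ μ(L̃) = 0` (and `λ(X) ≤ λ(L̃)`): `X[3]` finite = PIECE F. Why the additive prime is EASIER locally:
good ordinary ⇒ `Ê` of height one, local points twisted by the unit-root character, index needs Coleman/Perrin-Riou;
additive ⇒ `𝔾̂_a`, the index is a Frobenius determinant. The `Λ`-adic Coleman map is dead (universal norms `0`,
barrier `TraceZeroHeegnerTowerAtAdditiveSplitP`), finite-level indices are exact: obstruction as resource.

§3 is the PROVED obstruction leaf of this generation (barrier note B-g11-8): the **tempered no-go** over the barrier's
abstract tower API — a family of layer combinations whose relative norms are `p^{e_m}`-multiples of the previous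
member with `e_m ≤ 1` and `e_m = 0` infinitely often vanishes identically (`p` regular, `R` `p`-adically separated):
cumulative temper one (barrier (i)) is OPTIMAL inside the span, so «temper calibration / signed sub-towers / weighted
cumulative classes» cannot produce a better-than-tempered `Λ`-adic class.

Pieces and tags (D-0171): R = `RationalSplitIMCInclusionAtThree` (WEAKER, item 24207, staffed there);
F = `ResidualSelmerFiniteAtThreeSurj` (UNDECIDED; same normalised signature as `Lines/division_tower_mu_floor.lean`,
`fern_closure_doors`, `layer_fitting_doors` — dedup by signature); its NEW child is the chain (E1)…(H) above, typed where the
tree has the objects (CRT, tempered no-go: PROVED) and kept in the line card where it has not (twisted Selmer lengths,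
local Kummer indices: no `H¹(K, T ⊗ χ)` / `Module.length` of Selmer duals over `𝒪_k` in the tree). The composition §4
is the g8 road verbatim (credit: `DivisionTowerMuFloor.AdditiveSplitIMCInclusionAtThree_of`). Sorries ONLY in `stub_*`.
BSD is not advanced by this file beyond the two abstract proved lemmas.
References: [Howard2004HeegnerKolyvagin] Thm. A; [MazurRubin2004] Thm. 5.2.2, §3.1 (H.0)–(H.5); [CornutVatsal2007]
Thm. 1.5, Lemma 6.14; [BertoliniDarmonPrasanna2013] Thm. 5.13, §5; [Castella2013] Thm. A; [Hsieh2014] Thm. B;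
[BertoliniDarmon1996] §2.5 Case 2; [GreenbergVatsal2000] Prop. 2.8; Leopoldt 1959 / Lettl 1990 (local integers of
`ℚ₃(ζ_{3^m})` over the group ring); Fröhlich, *Galois module structure* (resolvents); Kurihara 2002 Invent. (finite-layer
θ-elements at supersingular `p` — the precedent for «finite layers when `Λ`-adic objects have denominators»).
-/

set_option linter.dupNamespace false
set_option autoImplicit false

noncomputable section

open Finset
open Literature.NumberTheory.EllipticCurves
open Summit.BirchSwinnertonDyer.BirchSwinnertonDyer.Theses.UniversalToricDescent
  (RationalSplitIMCInclusionAtThree AdditiveSplitIMCInclusionAtThree)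
open Summit.BirchSwinnertonDyer.BirchSwinnertonDyer.Cruxes.ToricTransportModThree.RatwallThinComb
  (dvd_of_dvd_prime_pow_mul prime_C_three not_C_three_dvd_of_norm_coeff_eq_one)
open Summit.BirchSwinnertonDyer.Rank1Residual.X11b

universe u v w

namespace Summit.BirchSwinnertonDyer.BirchSwinnertonDyer.Cruxes.AdditiveSplitIMCInclusionAtThree.ResolventLayerIndex

/-! ## §1 The typed piece the line feeds -/

/-- PIECE F (UNDECIDED; the `μ = 0` currency of the g8 kernel road, displayed verbatim from
`Lines/division_tower_mu_floor.lean` — same normalised signature). **Residual Selmer finiteness at `E`** on the UTD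
frame: `Sel_{𝔭′}(K_∞, E[3^∞])[3]` finite. Its NEW child in this node is the resolvent-exact layer chain (E1)…(H) of the
module docstring: per conductor `3^k`, `ℓ(X_(∅,0)(T ⊗ χ_k⁻¹)) ≤ 2·v(𝓛^{ac}(χ̄_k)) + O(1)`; summed with (CRT),
`μ(X_(∅,0)) ≤ 2μ(𝓛^{ac}) = 0`.
[cite: GreenbergVatsal2000, §2 Prop. (2.8)] [cite: Howard2004HeegnerKolyvagin, Thm. A] [cite: Hsieh2014, Thm. B] -/
def ResidualSelmerFiniteAtThreeSurj : Prop :=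
  ∀ (W : WeierstrassCurve ℚ) [W.IsElliptic] [W.IsGloballyMinimal] (N : ℕ) [NeZero N] (K : Type) [Field K] [NumberField K], Summit.BirchSwinnertonDyer.Rank1Residual.Additive.ClassO6 W 3 → W.HasSurjectiveModNGaloisRep 3 → W.analyticRank = 1 → W.conductorNorm ℤ = N → Literature.NumberTheory.EllipticCurves.IsImaginaryQuadratic K → Literature.NumberTheory.EllipticCurves.SatisfiesHeegnerHypothesis N K → ∀ (κ : Literature.NumberTheory.EllipticCurves.ZpExtension K 3), κ.IsAnticyclotomic → ∀ (𝔭' : IsDedekindDomain.HeightOneSpectrum (NumberField.RingOfIntegers K)), ((3 : ℕ) : NumberField.RingOfIntegers K) ∈ 𝔭'.asIdeal → Set.Finite {s : Summit.BirchSwinnertonDyer.Rank1Residual.X11b.AcSelmer.selmerAc (W.baseChange K) 3 κ 𝔭' ∅ | (3 : ℕ) • s = 0}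

/-! ## §2 PROVED leaf (CRT): the one-sided Chinese remainder inequality for lengths

The bookkeeping step of the line that B-g10-5 doubted: comparing a `ℤ₃[ℤ/3^m]`-module with its
`Φ_{3^k}`-coinvariants costs NOTHING in the direction of an upper bound. Abstractly: for a commutative ring `R`, an
`R`-module `M` and ring elements `x₁,…,x_n` with `(x₁⋯x_n)·M = 0`, `ℓ_R(M) ≤ Σᵢ ℓ_R(M/xᵢM)` (lengths in `ℕ∞`). -/

section CRT

variable {R : Type u} [CommRing R]

/-- `r·M` as a submodule of `M`: the range of multiplication by `r`. [cite: MazurRubin2004, §2.1 (notation `IM`)] -/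
abbrev smulTop (r : R) (M : Type v) [AddCommGroup M] [Module R M] : Submodule R M :=
  LinearMap.range (LinearMap.lsmul R M r)

/-- A surjection `M ↠ N` induces `M/sM ↠ N/sN`, so `ℓ(N/sN) ≤ ℓ(M/sM)`. [cite: MazurRubin2004, §2.1] -/
theorem length_quotient_smulTop_le_of_surjective {M : Type v} [AddCommGroup M] [Module R M]
    {N : Type w} [AddCommGroup N] [Module R N] (f : M →ₗ[R] N) (hf : Function.Surjective f) (s : R) :
    Module.length R (N ⧸ smulTop s N) ≤ Module.length R (M ⧸ smulTop s M) := by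
  have hle : smulTop s M ≤ (smulTop s N).comap f := by
    intro x hx
    obtain ⟨m, rfl⟩ := LinearMap.mem_range.mp hx
    exact Submodule.mem_comap.mpr
      (LinearMap.mem_range.mpr ⟨f m, by rw [LinearMap.lsmul_apply, LinearMap.lsmul_apply, map_smul]⟩)
  refine Module.length_le_of_surjective (Submodule.mapQ _ _ f hle) ?_
  intro q
  obtain ⟨n, rfl⟩ := Submodule.mkQ_surjective _ q
  obtain ⟨m, rfl⟩ := hf n
  exact ⟨(smulTop s M).mkQ m, by rw [Submodule.mkQ_apply, Submodule.mkQ_apply, Submodule.mapQ_apply]⟩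

/-- **One-sided CRT for lengths.** If `(∏ l)·M = 0` then `ℓ_R(M) ≤ Σ_{r ∈ l} ℓ_R(M/rM)`. Proof: filter `M ⊇ rM`,
`ℓ(M) = ℓ(M/rM) + ℓ(rM)`, and `rM` is a quotient of `M` killed by the remaining product, so induction and the previous
lemma apply. (The reverse inequality fails by the conductor of `ℤ_p[ℤ/p^m]` in its maximal order; only this direction
is used by the line.) [cite: MazurRubin2004, §2.1] [cite: Washington1997, §13.2 (growth of `ℓ(X/ω_m X)`)] -/
theorem length_le_sum_length_quotient (l : List R) :
    ∀ {M : Type v} [AddCommGroup M] [Module R M], (∀ m : M, l.prod • m = 0) →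
      Module.length R M ≤ (l.map fun r => Module.length R (M ⧸ smulTop r M)).sum := by
  induction l with
  | nil =>
    intro M _ _ h
    have : Subsingleton M := subsingleton_of_forall_eq 0 fun m => by simpa using h m
    rw [Module.length_eq_zero, List.map_nil, List.sum_nil]
  | cons r l ih =>
    intro M _ _ h
    have hN : ∀ n : ↥(smulTop r M), l.prod • n = 0 := by
      intro n
      obtain ⟨m, hm⟩ := LinearMap.mem_range.mp n.2
      rw [← Submodule.coe_eq_zero, Submodule.coe_smul, ← hm, LinearMap.lsmul_apply, smul_smul, mul_comm,
        ← List.prod_cons]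
      exact h m
    have hsplit := Module.length_eq_add_of_exact (smulTop r M).subtype (smulTop r M).mkQ
      (Submodule.subtype_injective _) (Submodule.mkQ_surjective _) (LinearMap.exact_subtype_mkQ _)
    rw [hsplit, List.map_cons, List.sum_cons, add_comm]
    refine add_le_add le_rfl ((ih hN).trans (List.sum_le_sum fun s _ => ?_))
    exact length_quotient_smulTop_le_of_surjective (LinearMap.lsmul R M r).rangeRestrict
      (LinearMap.surjective_rangeRestrict _) s

end CRT

/-! ## §3 PROVED obstruction leaf (B-g11-8): the tempered no-go over the barrier's abstract tower

Setting of `Literature.Barriers.BirchSwinnertonDyer.TraceZeroTower`: `γ ∈ End_R H`, layers `ker(γ^{p^m} − 1)`,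
relative norms `N_{m+1,m}`, a trace-zero family `y` (`y_k` in layer `k`, `N_{k+1,k} y_{k+1} = 0`), layer combinations
`z_m = Σ_{k≤m} c_{m,k} y_k`. The barrier proves: cumulative sums are `p`-TEMPERED (`N z_{m+1} = p·z_m`) and NO
norm-compatible family (`N z_{m+1} = z_m`) lives in the span. Here: nothing IN BETWEEN either — any family with
`N z_{m+1} = p^{e_m} z_m`, `e_m ≤ 1`, `e_m = 0` for infinitely many `m`, is zero. -/

section Tempered

open Literature.Barriers.BirchSwinnertonDyer.TraceZeroTower

variable {R : Type u} [CommRing R] {H : Type v} [AddCommGroup H] [Module R H]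

/-- **Tempered coefficient rigidity**: `N_{m+1,m} z_{m+1} = p^{e_m}·z_m` and linear independence of the `y_k` force
`p^{e_m}·c_{m,k} = p·c_{m+1,k}` for `k ≤ m`. [cite: BertoliniDarmon1996, §2.5 Case 2 (p. 435)]
[cite: CornutVatsal2007, Lemma 6.14] -/
theorem pow_mul_coeff_eq_mul_coeff_succ_of_tempered {γ : Module.End R H} {p : ℕ} {y : ℕ → H}
    (h : IsTraceZeroFamily γ p y) (hli : LinearIndependent R y) (c : ℕ → ℕ → R) (e : ℕ → ℕ)
    (hz : ∀ m, towerNorm γ p m (layerCombination c y (m + 1)) = (p : R) ^ e m • layerCombination c y m)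
    (m k : ℕ) (hk : k ≤ m) : (p : R) ^ e m * c m k = (p : R) * c (m + 1) k := by
  have hdiff : ∑ j ∈ range (m + 1), ((p : R) * c (m + 1) j - (p : R) ^ e m * c m j) • y j = 0 := by
    simp_rw [sub_smul]
    rw [Finset.sum_sub_distrib, ← towerNorm_layerCombination_succ h c m, hz m, layerCombination, Finset.smul_sum]
    simp_rw [smul_smul]
    rw [sub_self]
  have := (linearIndependent_iff'.mp hli) (range (m + 1))
    (fun j => (p : R) * c (m + 1) j - (p : R) ^ e m * c m j) hdiff k
    (Finset.mem_range.mpr (Nat.lt_succ_of_le hk))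
  exact (sub_eq_zero.mp this).symm

/-- **TEMPERED NO-GO (temper one is optimal in the span).** Let `y` be a trace-zero family with linearly
independent members over a ring `R` in which `p` is regular and `p`-adically separated. If a family of layer
combinations `z_m = Σ_{k≤m} c_{m,k} y_k` satisfies `N_{m+1,m} z_{m+1} = p^{e_m}·z_m` with every `e_m ≤ 1` and
`e_m = 0` for infinitely many `m` (cumulative temper `< 1`), then every `z_m` is `0`. With `e ≡ 0` this is the
barrier's (ii); with `e ≡ 1` the cumulative sums (barrier (i)) show the hypothesis «infinitely many `e_m = 0`»
cannot be dropped. Reading: no signed / weighted / calibrated sub-tempered `Λ`-adic class exists in the span of a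
trace-zero Heegner tower; the tempered class `κ♮` is the integral optimum and its defect is exactly one factor `p`
per layer. [cite: BertoliniDarmon1996, §2.5 Case 2 (p. 435)] [cite: CornutVatsal2007, Lemma 4.9 (iii), Lemma 6.14]
[cite: Howard2004HeegnerKolyvagin, Thm. 2 (input `κ₁ ∈ H¹(K,𝐓)`)] -/
theorem layerCombination_eq_zero_of_subTempered {γ : Module.End R H} {p : ℕ} {y : ℕ → H}
    (h : IsTraceZeroFamily γ p y) (hli : LinearIndependent R y)
    (hreg : ∀ a b : R, (p : R) * a = (p : R) * b → a = b)
    (hsep : ∀ r : R, (∀ j : ℕ, (p : R) ^ j ∣ r) → r = 0)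
    (c : ℕ → ℕ → R) (e : ℕ → ℕ) (he : ∀ m, e m ≤ 1) (hinf : ∀ M : ℕ, ∃ m, M ≤ m ∧ e m = 0)
    (hz : ∀ m, towerNorm γ p m (layerCombination c y (m + 1)) = (p : R) ^ e m • layerCombination c y m)
    (m : ℕ) : layerCombination c y m = 0 := by
  have hstep : ∀ j k, k ≤ j → e j = 0 → c j k = (p : R) * c (j + 1) k := by
    intro j k hk hj
    have := pow_mul_coeff_eq_mul_coeff_succ_of_tempered h hli c e hz j k hk
    rwa [hj, pow_zero, one_mul] at this
  have hkeep : ∀ j k, k ≤ j → ∃ t : R, c j k = t * c (j + 1) k := by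
    intro j k hk
    rcases Nat.le_one_iff_eq_zero_or_eq_one.mp (he j) with hj | hj
    · exact ⟨p, hstep j k hk hj⟩
    · have := pow_mul_coeff_eq_mul_coeff_succ_of_tempered h hli c e hz j k hk
      rw [hj, pow_one] at this
      exact ⟨1, by rw [one_mul]; exact hreg _ _ this⟩
  have hmono : ∀ J j k, k ≤ j → ∃ t : R, c j k = t * c (j + J) k := by
    intro J
    induction J with
    | zero => intro j k _; exact ⟨1, by rw [one_mul, add_zero]⟩
    | succ J ih =>
      intro j k hk
      obtain ⟨t, ht⟩ := ih j k hk
      obtain ⟨s, hs⟩ := hkeep (j + J) k (hk.trans (Nat.le_add_right j J))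
      exact ⟨t * s, by rw [ht, hs, mul_assoc, add_assoc]⟩
  have hdiv : ∀ n j k, k ≤ j → (p : R) ^ n ∣ c j k := by
    intro n
    induction n with
    | zero => intro j k _; exact ⟨c j k, by rw [pow_zero, one_mul]⟩
    | succ n ih =>
      intro j k hk
      obtain ⟨i, hji, hi⟩ := hinf j
      obtain ⟨t, ht⟩ := hmono (i - j) j k hk
      rw [Nat.add_sub_of_le hji] at ht
      obtain ⟨s, hs⟩ := ih (i + 1) k ((hk.trans hji).trans (Nat.le_succ i))
      refine ⟨t * s, ?_⟩
      rw [ht, hstep i k (hk.trans hji) hi, hs]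
      ring
  refine Finset.sum_eq_zero fun k hk => ?_
  rw [hsep _ (fun n => hdiv n m k (Nat.lt_succ_iff.mp (Finset.mem_range.mp hk))), zero_smul]

/-- The barrier's (ii) recovered as the case `e ≡ 0` (sanity link; one line). [cite: BertoliniDarmon1996, §2.5 Case 2] -/
theorem layerCombination_eq_zero_of_normCompatible' {γ : Module.End R H} {p : ℕ} {y : ℕ → H}
    (h : IsTraceZeroFamily γ p y) (hli : LinearIndependent R y)
    (hreg : ∀ a b : R, (p : R) * a = (p : R) * b → a = b)
    (hsep : ∀ r : R, (∀ j : ℕ, (p : R) ^ j ∣ r) → r = 0) (c : ℕ → ℕ → R)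
    (hz : ∀ m, towerNorm γ p m (layerCombination c y (m + 1)) = layerCombination c y m) (m : ℕ) :
    layerCombination c y m = 0 :=
  layerCombination_eq_zero_of_subTempered h hli hreg hsep c (fun _ => 0) (fun _ => Nat.zero_le 1)
    (fun M => ⟨M, le_rfl, rfl⟩) (fun m => by rw [hz m, pow_zero, one_smul]) m

/-- **The cumulative family is exactly tempered and nonzero**: the hypothesis «`e_m = 0` infinitely often» of the
no-go cannot be weakened to «some `e_m = 0`»-free temper one — barrier (i) exhibits `e ≡ 1` with `z_m = Y_m ≠ 0`
whenever `y_0 ≠ 0`. Stated as: the cumulative sums satisfy the temper-one relation (re-export of the barrier's (i) in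
the `layerCombination` normal form with the all-ones coefficient table). [cite: BertoliniDarmon1996, §2.5 Case 2] -/
theorem towerNorm_layerCombination_one_succ {γ : Module.End R H} {p : ℕ} {y : ℕ → H}
    (h : IsTraceZeroFamily γ p y) (m : ℕ) :
    towerNorm γ p m (layerCombination (fun _ _ => (1 : R)) y (m + 1)) =
      (p : R) ^ (1 : ℕ) • layerCombination (fun _ _ => (1 : R)) y m := by
  have hc : ∀ n, layerCombination (fun _ _ => (1 : R)) y n = cumulative y n := by
    intro n
    simp only [layerCombination, cumulative, one_smul]
  rw [hc, hc, pow_one, towerNorm_cumulative_succ h m]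

end Tempered

/-! ## §4 Registered stubs and the kernel road (g8 road, credit `DivisionTowerMuFloor`) -/

/-- STUB R (WEAKER than the wall; = route item 24207 `RationalSplitIMCInclusionAtThree` BY NAME, staffed there):
`∃ k, 3^k·L ∈ Ch·R₀⟦T⟧`. -/
theorem stub_ratwall : RationalSplitIMCInclusionAtThree := by
  sorry

/-- STUB F (UNDECIDED): residual Selmer finiteness `Sel_{𝔭′}(K_∞, E[3^∞])[3]` finite — fed by the resolvent-exact
layer chain (E1)…(H) of this node (line card §1), whose typed-and-proved fragments are §2 (CRT) and §3. -/
theorem stub_residualFinite : ResidualSelmerFiniteAtThreeSurj := by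
  sorry

/-- **The wall from the rational wall and residual Selmer finiteness** (g8 road verbatim): `X[3]` finite makes
`X = X_(∅,0)` `Λ`-torsion with `Ch·R₀⟦T⟧ = (g)`, `g` having a unit coefficient (LANDED criterion); `3 ∤ g` in the
domain `R₀⟦T⟧` where `3` is prime, so `g ∣ 3^k·L` (RATWALL) forces `g ∣ L`. Concludes the crux
`AdditiveSplitIMCInclusionAtThree` BY NAME. [cite: GreenbergVatsal2000, §2 Prop. (2.8)] [cite: Washington1997, §7.1, §13.2] -/
theorem AdditiveSplitIMCInclusionAtThree_of :
    RationalSplitIMCInclusionAtThree → ResidualSelmerFiniteAtThreeSurj → AdditiveSplitIMCInclusionAtThree := by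
  intro hR hF W _ _ N _ K _ _ Dt hO6 hsurj hr1 hN hK hH κ hκ γ _ 𝔭 h3 he hf 𝔭' h3' hne ι' hι ΩK Ωp L hΩK hΩp hL
  obtain ⟨k, hk⟩ := hR W N K Dt hO6 hsurj hr1 hN hK hH κ hκ γ 𝔭 h3 he hf 𝔭' h3' hne ι' hι ΩK Ωp L hΩK hΩp hL
  have hfin := hF W N K hO6 hsurj hr1 hN hK hH κ hκ 𝔭' h3'
  obtain ⟨-, g, hg, i, hi⟩ :=
    Summit.BirchSwinnertonDyer.BirchSwinnertonDyer.Theorems.UniversalToricDescentAcDualMuZero.isTorsion_and_exists_generator_of_finite_pTorsion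
      (W.baseChange K) 3 κ 𝔭' ∅ γ Set.finite_empty hfin
  rw [hg] at hk ⊢
  have hdvd : g ∣ ((3 : ℕ) : UnrSeries 3) ^ k * L := Ideal.mem_span_singleton.mp hk
  rw [← map_natCast (PowerSeries.C (R := unrIntegers 3))] at hdvd
  exact Ideal.span_singleton_le_span_singleton.mpr
    (dvd_of_dvd_prime_pow_mul prime_C_three (not_C_three_dvd_of_norm_coeff_eq_one hi) k hdvd)

/-- The top composition run on the registered stubs: the crux BY NAME (sorries only through `stub_*`). -/
theorem AdditiveSplitIMCInclusionAtThree_holds_of_stubs : AdditiveSplitIMCInclusionAtThree :=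
  AdditiveSplitIMCInclusionAtThree_of stub_ratwall stub_residualFinite

end Summit.BirchSwinnertonDyer.BirchSwinnertonDyer.Cruxes.AdditiveSplitIMCInclusionAtThree.ResolventLayerIndex

end
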